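import Summits.QuantumFields.YangMills.Theorems.IR.Negative.OuterCertInertIff

/-!
# At the IR level: the `δ`-uniform outer certificate is physical strong mixing, verbatim

Third file of the inertness chain for crux `IR` (item stmt-QuantumFields-19354; v10 `IR_birth_cell_v10.lean`
sha 88d42543849b7401, open stub `stub_outerCert : IROuterCertificate`; tree copy of the stub statement:
`OuterCertWire.IROuterCertificate`).  Kernel-checked, no `sorry`, standard axioms, no new definitions.

* `irUniformOuterCert_iff_physicalStrongMixing` — v10's `IROuterCertificate` with the single quantifier swap
  `∃ β₂, ∀ β ≥ β₂, ∀ δ > 0` (instead of `∀ δ > 0, ∃ β₂, ∀ β ≥ β₂`) is EQUIVALENT to triage seat 1's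
  `PhysicalStrongMixing` (`UnivBridgeProof.lean`, evidence #60; its body is the right-hand side verbatim, with
  `shellCount n` unfolded to `(4n+3)^4 - (4n+1)^4`): untempered `ε`-insensitivity of centre-cell expectations to
  arbitrary outer-shell data beyond `β₂`, at scale `b = ⌈ℓ / a β⌉₊`.  Second countability of `G` comes from the
  faithful continuous matrix model `r` (closed embedding), so no hypothesis beyond v10's own appears.
* `irOuterCertificate_of_uniform` — the `δ`-uniform certificate implies v10's stub statement (monotonicity only).

So the content of v10's tempering is confined to the converse of `irOuterCertificate_of_uniform`, i.e. to
certificates whose onset `β₂(δ)` genuinely diverges as `δ → 0`; whether physics forces that is the subject of the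
film census (kit j262990 / j263063) recorded on the item, not of this file.
-/

noncomputable section

open Filter Topology MeasureTheory
open Literature.MathematicalPhysics.QuantumFieldTheory Literature.MathematicalPhysics.QuantumLattice
open Literature.Probability.LatticeModels
open Summit.QuantumFields.YangMills.Cruxes.OSLegsFromFemtoAndGap.DlrCollarTransfer (LowerBounds)
open Summit.QuantumFields.YangMills.Cruxes.IR.Tempered (cellEdges windowCells regionEdges)
open Summit.QuantumFields.YangMills.Cruxes.IR.ShellTempered (windowCellsPlus)
open Summit.QuantumFields.YangMills.Cruxes.IR.OuterCertWire (OuterTemperedCond IROuterCertificate)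

namespace Summit.QuantumFields.YangMills.Cruxes.IR.OuterCertInert

/-- **`δ`-uniform IR outer certificate ⇔ physical strong mixing (seat 1), verbatim.** -/
theorem irUniformOuterCert_iff_physicalStrongMixing :
    (∀ (G : Type) [Group G] [TopologicalSpace G] [IsTopologicalGroup G] [CompactSpace G],
      IsCompactSimpleLieGroup G → letI : MeasurableSpace G := borel G; haveI : BorelSpace G := ⟨rfl⟩;
      ∀ (r : LatticeRep G) (a : ℝ → ℝ), (∀ β, 0 < a β) → Tendsto a atTop (𝓝 0) → LowerBounds G r a →
        ∃ ℓ : ℝ, 0 < ℓ ∧ ∃ (n : ℕ) (ε : ℝ), 1 ≤ n ∧ 0 ≤ ε ∧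
          ε * ((((4 * n + 3) ^ 4 - (4 * n + 1) ^ 4 : ℕ)) : ℝ) < 1 ∧
          ∃ β₂ : ℝ, ∀ β : ℝ, β₂ ≤ β → ∀ δ : ℝ, 0 < δ → OuterTemperedCond r.ρ β ⌈ℓ / a β⌉₊ n ε δ) ↔
    (∀ (G : Type) [Group G] [TopologicalSpace G] [IsTopologicalGroup G] [CompactSpace G],
      IsCompactSimpleLieGroup G → letI : MeasurableSpace G := borel G; haveI : BorelSpace G := ⟨rfl⟩;
      ∀ (r : LatticeRep G) (a : ℝ → ℝ), (∀ β, 0 < a β) → Tendsto a atTop (𝓝 0) → LowerBounds G r a →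
        ∃ ℓ : ℝ, 0 < ℓ ∧ ∃ (n : ℕ) (ε : ℝ), 1 ≤ n ∧ 0 ≤ ε ∧
          ε * ((((4 * n + 3) ^ 4 - (4 * n + 1) ^ 4 : ℕ)) : ℝ) < 1 ∧
          ∃ β₂ : ℝ, ∀ β : ℝ, β₂ ≤ β →
            ∀ w : Fin 4 → ℤ → ℤ,
              (∀ i j, w i j + ((⌈ℓ / a β⌉₊ : ℕ) : ℤ) ≤ w i (j + 1) ∧
                w i (j + 1) ≤ w i j + 2 * ((⌈ℓ / a β⌉₊ : ℕ) : ℤ)) →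
              ∀ Y : Finset (Fin 4 → ℤ), Y ⊆ windowCells n → (0 : Fin 4 → ℤ) ∈ Y →
                ∀ σ σ' : LGConfig 4 G,
                  (∀ c ∈ windowCellsPlus n, c ∉ Y → c ∈ windowCells n →
                    ∀ e ∈ cellEdges w c, σ e = σ' e) →
                  ∀ f : LGConfig 4 G → ℝ, IsCylinder f (cellEdges w 0) → Measurable f →
                    (∀ U, 0 ≤ f U ∧ f U ≤ 1) →
                    |(∫ U, f U ∂(ymSpecification r.ρ β (regionEdges w Y) σ)) -
                      ∫ U, f U ∂(ymSpecification r.ρ β (regionEdges w Y) σ')| ≤ ε) := by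
  constructor
  · intro h G _ _ _ _ hG r a hapos ha hLB
    letI : MeasurableSpace G := borel G
    haveI : BorelSpace G := ⟨rfl⟩
    haveI : SecondCountableTopology G :=
      (r.continuous.isClosedEmbedding r.injective).isEmbedding.secondCountableTopology
    obtain ⟨ℓ, hℓ, n, ε, hn, hε, hM, hU⟩ := h G hG r a hapos ha hLB
    exact ⟨ℓ, hℓ, n, ε, hn, hε, hM,
      (uniformOuterCert_iff_eventually_univShell r.continuous (fun β => ⌈ℓ / a β⌉₊) n ε).1 hU⟩
  · intro h G _ _ _ _ hG r a hapos ha hLB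
    letI : MeasurableSpace G := borel G
    haveI : BorelSpace G := ⟨rfl⟩
    haveI : SecondCountableTopology G :=
      (r.continuous.isClosedEmbedding r.injective).isEmbedding.secondCountableTopology
    obtain ⟨ℓ, hℓ, n, ε, hn, hε, hM, hU⟩ := h G hG r a hapos ha hLB
    exact ⟨ℓ, hℓ, n, ε, hn, hε, hM,
      (uniformOuterCert_iff_eventually_univShell r.continuous (fun β => ⌈ℓ / a β⌉₊) n ε).2 hU⟩

/-- **The `δ`-uniform certificate implies v10's stub statement** `IROuterCertificate` (monotonicity in the
quantifier order; the converse is what tempering could add and is not claimed). -/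
theorem irOuterCertificate_of_uniform
    (h : ∀ (G : Type) [Group G] [TopologicalSpace G] [IsTopologicalGroup G] [CompactSpace G],
      IsCompactSimpleLieGroup G → letI : MeasurableSpace G := borel G; haveI : BorelSpace G := ⟨rfl⟩;
      ∀ (r : LatticeRep G) (a : ℝ → ℝ), (∀ β, 0 < a β) → Tendsto a atTop (𝓝 0) → LowerBounds G r a →
        ∃ ℓ : ℝ, 0 < ℓ ∧ ∃ (n : ℕ) (ε : ℝ), 1 ≤ n ∧ 0 ≤ ε ∧
          ε * ((((4 * n + 3) ^ 4 - (4 * n + 1) ^ 4 : ℕ)) : ℝ) < 1 ∧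
          ∃ β₂ : ℝ, ∀ β : ℝ, β₂ ≤ β → ∀ δ : ℝ, 0 < δ → OuterTemperedCond r.ρ β ⌈ℓ / a β⌉₊ n ε δ) :
    IROuterCertificate := by
  intro G _ _ _ _ hG r a hapos ha hLB
  obtain ⟨ℓ, hℓ, n, ε, hn, hε, hM, β₂, hU⟩ := h G hG r a hapos ha hLB
  exact ⟨ℓ, hℓ, n, ε, hn, hε, hM, fun δ hδ => ⟨β₂, fun β hβ => hU β hβ δ hδ⟩⟩

end Summit.QuantumFields.YangMills.Cruxes.IR.OuterCertInert
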